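import Summits.QuantumFields.YangMills.Theorems.UnitScaleTiltProp7ClosedFibreHalving
import HarnessLib

/-!
# Route `UnitScaleTilt`, crux K1 child «MinimiserStabilityRegPr» (stmt-QuantumFields-19200), skeleton v10 {`stub_halvingStep`, `stub_existenceMinimalOrbit`} —
# THE EXISTENCE STUB ON ROUTE (β): THE INTERIORITY SENTENCE AT ONE FIXED RADIUS, SPLIT INTO ITS PLAQUETTE HALF AND ITS DIVERGENCE HALF (the two
# clauses of [Balaban1985Variational] (2)), and the registered text from PROP. 8 and the two halves

Cell `ym3-torus`, width seat `ym-ust-19200-w4` (gen 0; INTERIOR-sentence owner on route (β), OWNER 2026-08-28 01:18:38Z; halves for the assisting seats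
20520-w2 g2 (PLAQUETTE) and 20520-w5 g0 (DIVERGENCE ∕ axial-gauge)).  THEOREMS ONLY (0 `def`, 0 `sorry`); builds on `Prop7ClosedFibreHalving` §4
(`existenceMinimalOrbit_of_prop8_of_interiorAtR`, p593136) and 20520-w4's direct method (`Prop7ClosedFibreMinimiser`, p591314).  YM₃ on T³ is a ladder rung
(R3), not the Clay problem; nothing here claims the stub, the crux, d = 4 or the mass gap.

THE TARGETS, BY NAME (for the suppliers; both at ONE FIXED radius `R ≤ R₁(L, B₃)`, data as regular as needed, `ε₁ ≤ a′₁(R)`):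
* PLAQ-INTERIOR-AT-R (`hPl`): every minimiser `Ū` of the Wilson action over the CLOSED fibre `(6̄)(R) ∩ 𝔅_k(V)` — `V` a (7)-datum at `ε₁`, background
  `U₀ ∈ 𝔘_k(L³B₃ε₁) ∩ 𝔅_k(V)` — has STRICT plaquette bounds `|Ū(∂p) − 1| < R·L^{−2(K−n)}` (`PlaqSmall (regThreshold F n K R) Ū`), i.e. no plaquette of a
  minimiser sits on the shell of the first clause of (2);
* DIV-INTERIOR-AT-R (`hDv`): the same minimisers have STRICT covariant-divergence bounds `‖(D^{1*}_Ū ∂Ū)(b)‖ < R·L^{−3(K−n)}` (`DivSmall F n K R Ū`), the second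
  clause of (2) ∕ [Balaban1985RegularSpaces] (1.9).
Their conjunction IS `RegPr F n K R Ū` (definitional), the interiority sentence `hIR` of `existenceMinimalOrbit_of_prop8_of_interiorAtR`.

WHAT IS PROVED (ns `…Theorems.Prop7ClosedFibreInteriorAtR`; sibling of 20520-w4's `UnitScaleTiltProp7ClosedFibreInteriorSplit`, whose halves are stated on the radius WINDOW down to `L³B₃ε₁` without Prop. 8 — here the halves are asked at ONE FIXED radius only, Prop. 8 doing the shrinking).  `interiorAtR_of_halves : hPl → hDv → hIR` (thresholds `R₁ := min`, `a′₁ := min`) and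
★ `existenceMinimalOrbit_of_prop8_of_halves : landed_prop8-text → hPl → hDv → <stub_existenceMinimalOrbit text verbatim>`.  So under v10 the existence stub
on route (β) reads: PROP. 8 (= the other stub iterated, `Prop8Iter`) ∧ PLAQ-INTERIOR-AT-R ∧ DIV-INTERIOR-AT-R — the two displayed sentences are the a-priori
(KKT) content of [Balaban1985Variational] Sect. F (158)–(165) «with a sign» at a closed-fibre minimiser, at a single macroscopic radius.

HONEST SCOPE.  Bookkeeping only (`RegPr = PlaqSmall ∧ DivSmall`, minima of thresholds); `hPl`, `hDv`, Prop. 8 are displayed hypotheses; nothing of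
[Balaban1985Variational] is asserted; `--supports stmt-QuantumFields-19200`, count-neutral.

References: T. Bałaban, CMP 102 (1985) 277–309 [Balaban1985Variational] ((2) p.278, (14) p.280, Prop. 7 p.299, Prop. 8 and (158)–(165) pp.302–304);
CMP 99 (1985) 75–102 [Balaban1985RegularSpaces] ((1.7)–(1.9) p.77).
-/

set_option autoImplicit false

noncomputable section

namespace Summit.QuantumFields.YangMills.Theorems.Prop7ClosedFibreInteriorAtR

open Set
open scoped Matrix.Norms.L2Operator
open Literature.MathematicalPhysics.QuantumFieldTheory.Balaban1983to89
open Literature.MathematicalPhysics.QuantumFieldTheory.Balaban1983to89.T3ContinuumYM3Torus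
open Literature.MathematicalPhysics.QuantumFieldTheory.Balaban1983to89.T3UnitLawDensityEML (ℰp)
open Literature.MathematicalPhysics.QuantumFieldTheory.Balaban1983to89.T3PrintedRegularMinimiser (RegPr DivSmall regFibrePr)
open Literature.MathematicalPhysics.QuantumFieldTheory.Balaban1983to89.T3RegularMinimiser (regThreshold)
open Literature.MathematicalPhysics.QuantumFieldTheory.Balaban1983to89.T3ConstrainedMinimiser (fibre)
open Literature.MathematicalPhysics.QuantumFieldTheory.Balaban1983to89.T3TiltDescent (descendTo)
open Literature.MathematicalPhysics.QuantumFieldTheory.Balaban1983to89.B10Eq27TorusAxialLog (toUField unitsField)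
open Literature.MathematicalPhysics.QuantumFieldTheory.Balaban1983to89.B10Eq68TorusRegularity (covDivT)
open Summit.QuantumFields.YangMills.Theorems.Prop7ClosedFibreHalving (existenceMinimalOrbit_of_prop8_of_interiorAtR)

/-- **THE INTERIORITY SENTENCE AT ONE RADIUS FROM ITS TWO HALVES** (`RegPr = PlaqSmall ∧ DivSmall`, the two clauses of [Balaban1985Variational] (2)): the
PLAQUETTE half `hPl` (strict plaquette bounds at a closed-fibre minimiser at radius `R`) and the DIVERGENCE half `hDv` (strict covariant-divergence bounds at the
same minimisers), each with its own thresholds `R₁`, `a′₁(R)`, give the sentence `hIR` of `Prop7ClosedFibreHalving.existenceMinimalOrbit_of_prop8_of_interiorAtR`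
with the minima of the thresholds. [cite: Balaban1985Variational, (2) p.278, Prop. 8 p.304; Balaban1985RegularSpaces, (1.7)-(1.9) p.77] -/
theorem interiorAtR_of_halves
    (hPl : ∀ L : ℕ, 1 < L → ∀ B₃ : ℝ, 4 < B₃ → ∃ R₁ : ℝ, 0 < R₁ ∧ ∀ R : ℝ, 0 < R → R ≤ R₁ → ∃ a₁' : ℝ, 0 < a₁' ∧
      ∀ F : T3Family, F.L = L → ∀ (n K : ℕ) (hnK : n < K) (ε₁ : ℝ), 0 < ε₁ → ε₁ ≤ a₁' →
        ∀ V : GaugeField (F.P n) 0 (Matrix.specialUnitaryGroup (Fin 2) ℂ), PlaqSmall ε₁ V →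
          ∀ U₀ : GaugeField (F.P K) 0 (Matrix.specialUnitaryGroup (Fin 2) ℂ), RegPr F n K ((L : ℝ) ^ 3 * B₃ * ε₁) U₀ →
            U₀ ∈ fibre F ℰp n K hnK.le V →
            ∀ Ū : GaugeField (F.P K) 0 (Matrix.specialUnitaryGroup (Fin 2) ℂ),
              Ū ∈ {U : GaugeField (F.P K) 0 (Matrix.specialUnitaryGroup (Fin 2) ℂ) | ∀ p : Plaq (F.P K) 0,
                  GaugeGroup.dist1 (GaugeField.plaqHol U p) ≤ regThreshold F n K R} ∩ descendTo F ℰp n K hnK.le ⁻¹' {V} ∩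
                {U | ∀ b : PBond (F.P K) 0, ‖covDivT 1 (unitsField (toUField U)) b.dir b.src‖ ≤ R * ((F.L : ℝ)⁻¹) ^ (3 * (K - n))} →
              IsMinOn (fun W : GaugeField (F.P K) 0 (Matrix.specialUnitaryGroup (Fin 2) ℂ) => wilsonAction4 W)
                ({U : GaugeField (F.P K) 0 (Matrix.specialUnitaryGroup (Fin 2) ℂ) | ∀ p : Plaq (F.P K) 0,
                  GaugeGroup.dist1 (GaugeField.plaqHol U p) ≤ regThreshold F n K R} ∩ descendTo F ℰp n K hnK.le ⁻¹' {V} ∩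
                {U | ∀ b : PBond (F.P K) 0, ‖covDivT 1 (unitsField (toUField U)) b.dir b.src‖ ≤ R * ((F.L : ℝ)⁻¹) ^ (3 * (K - n))}) Ū →
              PlaqSmall (regThreshold F n K R) Ū)
    (hDv : ∀ L : ℕ, 1 < L → ∀ B₃ : ℝ, 4 < B₃ → ∃ R₁ : ℝ, 0 < R₁ ∧ ∀ R : ℝ, 0 < R → R ≤ R₁ → ∃ a₁' : ℝ, 0 < a₁' ∧
      ∀ F : T3Family, F.L = L → ∀ (n K : ℕ) (hnK : n < K) (ε₁ : ℝ), 0 < ε₁ → ε₁ ≤ a₁' →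
        ∀ V : GaugeField (F.P n) 0 (Matrix.specialUnitaryGroup (Fin 2) ℂ), PlaqSmall ε₁ V →
          ∀ U₀ : GaugeField (F.P K) 0 (Matrix.specialUnitaryGroup (Fin 2) ℂ), RegPr F n K ((L : ℝ) ^ 3 * B₃ * ε₁) U₀ →
            U₀ ∈ fibre F ℰp n K hnK.le V →
            ∀ Ū : GaugeField (F.P K) 0 (Matrix.specialUnitaryGroup (Fin 2) ℂ),
              Ū ∈ {U : GaugeField (F.P K) 0 (Matrix.specialUnitaryGroup (Fin 2) ℂ) | ∀ p : Plaq (F.P K) 0,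
                  GaugeGroup.dist1 (GaugeField.plaqHol U p) ≤ regThreshold F n K R} ∩ descendTo F ℰp n K hnK.le ⁻¹' {V} ∩
                {U | ∀ b : PBond (F.P K) 0, ‖covDivT 1 (unitsField (toUField U)) b.dir b.src‖ ≤ R * ((F.L : ℝ)⁻¹) ^ (3 * (K - n))} →
              IsMinOn (fun W : GaugeField (F.P K) 0 (Matrix.specialUnitaryGroup (Fin 2) ℂ) => wilsonAction4 W)
                ({U : GaugeField (F.P K) 0 (Matrix.specialUnitaryGroup (Fin 2) ℂ) | ∀ p : Plaq (F.P K) 0,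
                  GaugeGroup.dist1 (GaugeField.plaqHol U p) ≤ regThreshold F n K R} ∩ descendTo F ℰp n K hnK.le ⁻¹' {V} ∩
                {U | ∀ b : PBond (F.P K) 0, ‖covDivT 1 (unitsField (toUField U)) b.dir b.src‖ ≤ R * ((F.L : ℝ)⁻¹) ^ (3 * (K - n))}) Ū →
              DivSmall F n K R Ū) :
    ∀ L : ℕ, 1 < L → ∀ B₃ : ℝ, 4 < B₃ → ∃ R₁ : ℝ, 0 < R₁ ∧ ∀ R : ℝ, 0 < R → R ≤ R₁ → ∃ a₁' : ℝ, 0 < a₁' ∧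
      ∀ F : T3Family, F.L = L → ∀ (n K : ℕ) (hnK : n < K) (ε₁ : ℝ), 0 < ε₁ → ε₁ ≤ a₁' →
        ∀ V : GaugeField (F.P n) 0 (Matrix.specialUnitaryGroup (Fin 2) ℂ), PlaqSmall ε₁ V →
          ∀ U₀ : GaugeField (F.P K) 0 (Matrix.specialUnitaryGroup (Fin 2) ℂ), RegPr F n K ((L : ℝ) ^ 3 * B₃ * ε₁) U₀ →
            U₀ ∈ fibre F ℰp n K hnK.le V →
            ∀ Ū : GaugeField (F.P K) 0 (Matrix.specialUnitaryGroup (Fin 2) ℂ),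
              Ū ∈ {U : GaugeField (F.P K) 0 (Matrix.specialUnitaryGroup (Fin 2) ℂ) | ∀ p : Plaq (F.P K) 0,
                  GaugeGroup.dist1 (GaugeField.plaqHol U p) ≤ regThreshold F n K R} ∩ descendTo F ℰp n K hnK.le ⁻¹' {V} ∩
                {U | ∀ b : PBond (F.P K) 0, ‖covDivT 1 (unitsField (toUField U)) b.dir b.src‖ ≤ R * ((F.L : ℝ)⁻¹) ^ (3 * (K - n))} →
              IsMinOn (fun W : GaugeField (F.P K) 0 (Matrix.specialUnitaryGroup (Fin 2) ℂ) => wilsonAction4 W)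
                ({U : GaugeField (F.P K) 0 (Matrix.specialUnitaryGroup (Fin 2) ℂ) | ∀ p : Plaq (F.P K) 0,
                  GaugeGroup.dist1 (GaugeField.plaqHol U p) ≤ regThreshold F n K R} ∩ descendTo F ℰp n K hnK.le ⁻¹' {V} ∩
                {U | ∀ b : PBond (F.P K) 0, ‖covDivT 1 (unitsField (toUField U)) b.dir b.src‖ ≤ R * ((F.L : ℝ)⁻¹) ^ (3 * (K - n))}) Ū →
              RegPr F n K R Ū := by
  intro L hL B₃ hB₃
  obtain ⟨R₁, hR₁, HP⟩ := hPl L hL B₃ hB₃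
  obtain ⟨R₂, hR₂, HD⟩ := hDv L hL B₃ hB₃
  refine ⟨min R₁ R₂, lt_min hR₁ hR₂, fun R hR hRle => ?_⟩
  obtain ⟨a₁, ha₁, HP'⟩ := HP R hR (hRle.trans (min_le_left _ _))
  obtain ⟨a₂, ha₂, HD'⟩ := HD R hR (hRle.trans (min_le_right _ _))
  refine ⟨min a₁ a₂, lt_min ha₁ ha₂, fun F hF n K hnK ε₁ hε₁ hε₁a V hV U₀ hreg hfib Ū hŪ hmin => ⟨?_, ?_⟩⟩
  · exact HP' F hF n K hnK ε₁ hε₁ (hε₁a.trans (min_le_left _ _)) V hV U₀ hreg hfib Ū hŪ hmin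
  · exact HD' F hF n K hnK ε₁ hε₁ (hε₁a.trans (min_le_right _ _)) V hV U₀ hreg hfib Ū hŪ hmin

/-- ★ **THE REGISTERED EXISTENCE STUB (skeleton v10 ∕ route-R) ⇐ PROP. 8 ∧ PLAQ-INTERIOR-AT-R ∧ DIV-INTERIOR-AT-R.**  `hP8` = v10's `landed_prop8` text
VERBATIM (a theorem modulo `stub_halvingStep` in the tree); `hPl`, `hDv` = the two halves above.  Conclusion: the text of `stub_existenceMinimalOrbit`
(`Prop7ClosedFibreHalving.existenceMinimalOrbit_of_prop8_of_interiorAtR` after `interiorAtR_of_halves`). [cite: Balaban1985Variational, Prop. 7 p.299, Prop. 8 p.304, (14) p.280] -/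
theorem existenceMinimalOrbit_of_prop8_of_halves
    (hP8 : ∀ L : ℕ, 1 < L → ∃ B₃ : ℝ, 4 < B₃ ∧ B11.Prop8Printed B₃ (T3Thm1Carrier.famX L))
    (hPl : ∀ L : ℕ, 1 < L → ∀ B₃ : ℝ, 4 < B₃ → ∃ R₁ : ℝ, 0 < R₁ ∧ ∀ R : ℝ, 0 < R → R ≤ R₁ → ∃ a₁' : ℝ, 0 < a₁' ∧
      ∀ F : T3Family, F.L = L → ∀ (n K : ℕ) (hnK : n < K) (ε₁ : ℝ), 0 < ε₁ → ε₁ ≤ a₁' →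
        ∀ V : GaugeField (F.P n) 0 (Matrix.specialUnitaryGroup (Fin 2) ℂ), PlaqSmall ε₁ V →
          ∀ U₀ : GaugeField (F.P K) 0 (Matrix.specialUnitaryGroup (Fin 2) ℂ), RegPr F n K ((L : ℝ) ^ 3 * B₃ * ε₁) U₀ →
            U₀ ∈ fibre F ℰp n K hnK.le V →
            ∀ Ū : GaugeField (F.P K) 0 (Matrix.specialUnitaryGroup (Fin 2) ℂ),
              Ū ∈ {U : GaugeField (F.P K) 0 (Matrix.specialUnitaryGroup (Fin 2) ℂ) | ∀ p : Plaq (F.P K) 0,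
                  GaugeGroup.dist1 (GaugeField.plaqHol U p) ≤ regThreshold F n K R} ∩ descendTo F ℰp n K hnK.le ⁻¹' {V} ∩
                {U | ∀ b : PBond (F.P K) 0, ‖covDivT 1 (unitsField (toUField U)) b.dir b.src‖ ≤ R * ((F.L : ℝ)⁻¹) ^ (3 * (K - n))} →
              IsMinOn (fun W : GaugeField (F.P K) 0 (Matrix.specialUnitaryGroup (Fin 2) ℂ) => wilsonAction4 W)
                ({U : GaugeField (F.P K) 0 (Matrix.specialUnitaryGroup (Fin 2) ℂ) | ∀ p : Plaq (F.P K) 0,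
                  GaugeGroup.dist1 (GaugeField.plaqHol U p) ≤ regThreshold F n K R} ∩ descendTo F ℰp n K hnK.le ⁻¹' {V} ∩
                {U | ∀ b : PBond (F.P K) 0, ‖covDivT 1 (unitsField (toUField U)) b.dir b.src‖ ≤ R * ((F.L : ℝ)⁻¹) ^ (3 * (K - n))}) Ū →
              PlaqSmall (regThreshold F n K R) Ū)
    (hDv : ∀ L : ℕ, 1 < L → ∀ B₃ : ℝ, 4 < B₃ → ∃ R₁ : ℝ, 0 < R₁ ∧ ∀ R : ℝ, 0 < R → R ≤ R₁ → ∃ a₁' : ℝ, 0 < a₁' ∧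
      ∀ F : T3Family, F.L = L → ∀ (n K : ℕ) (hnK : n < K) (ε₁ : ℝ), 0 < ε₁ → ε₁ ≤ a₁' →
        ∀ V : GaugeField (F.P n) 0 (Matrix.specialUnitaryGroup (Fin 2) ℂ), PlaqSmall ε₁ V →
          ∀ U₀ : GaugeField (F.P K) 0 (Matrix.specialUnitaryGroup (Fin 2) ℂ), RegPr F n K ((L : ℝ) ^ 3 * B₃ * ε₁) U₀ →
            U₀ ∈ fibre F ℰp n K hnK.le V →
            ∀ Ū : GaugeField (F.P K) 0 (Matrix.specialUnitaryGroup (Fin 2) ℂ),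
              Ū ∈ {U : GaugeField (F.P K) 0 (Matrix.specialUnitaryGroup (Fin 2) ℂ) | ∀ p : Plaq (F.P K) 0,
                  GaugeGroup.dist1 (GaugeField.plaqHol U p) ≤ regThreshold F n K R} ∩ descendTo F ℰp n K hnK.le ⁻¹' {V} ∩
                {U | ∀ b : PBond (F.P K) 0, ‖covDivT 1 (unitsField (toUField U)) b.dir b.src‖ ≤ R * ((F.L : ℝ)⁻¹) ^ (3 * (K - n))} →
              IsMinOn (fun W : GaugeField (F.P K) 0 (Matrix.specialUnitaryGroup (Fin 2) ℂ) => wilsonAction4 W)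
                ({U : GaugeField (F.P K) 0 (Matrix.specialUnitaryGroup (Fin 2) ℂ) | ∀ p : Plaq (F.P K) 0,
                  GaugeGroup.dist1 (GaugeField.plaqHol U p) ≤ regThreshold F n K R} ∩ descendTo F ℰp n K hnK.le ⁻¹' {V} ∩
                {U | ∀ b : PBond (F.P K) 0, ‖covDivT 1 (unitsField (toUField U)) b.dir b.src‖ ≤ R * ((F.L : ℝ)⁻¹) ^ (3 * (K - n))}) Ū →
              DivSmall F n K R Ū) :
    ∀ L : ℕ, 1 < L → ∀ B₃ : ℝ, 4 < B₃ → ∃ a₁' O₁ : ℝ, 0 < a₁' ∧ 1 ≤ O₁ ∧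
      ∀ F : T3Family, F.L = L → ∀ (n K : ℕ) (hnK : n < K) (ε₁ : ℝ), 0 < ε₁ →
        ∀ V : GaugeField (F.P n) 0 (Matrix.specialUnitaryGroup (Fin 2) ℂ), PlaqSmall ε₁ V →
          ∀ U₀ : GaugeField (F.P K) 0 (Matrix.specialUnitaryGroup (Fin 2) ℂ), RegPr F n K ((L : ℝ) ^ 3 * B₃ * ε₁) U₀ →
            U₀ ∈ fibre F ℰp n K hnK.le V → ε₁ ≤ a₁' →
              ∃ U ∈ regFibrePr F n K hnK.le (O₁ * (L : ℝ) ^ 3 * B₃ * ε₁) V,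
                IsMinOn (fun W : GaugeField (F.P K) 0 (Matrix.specialUnitaryGroup (Fin 2) ℂ) => wilsonAction4 W)
                  (regFibrePr F n K hnK.le (O₁ * (L : ℝ) ^ 3 * B₃ * ε₁) V) U :=
  existenceMinimalOrbit_of_prop8_of_interiorAtR hP8 (interiorAtR_of_halves hPl hDv)

end Summit.QuantumFields.YangMills.Theorems.Prop7ClosedFibreInteriorAtR

end
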